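import Summits.AtomisticToContinuum.Crystallization.Theses.PhononSlackCertificates
import Summits.AtomisticToContinuum.Crystallization.Theorems.MinimiserShells.Negative.LoadBearing
import Literature.Probability.Process.LocallyMatches
import Literature.Probability.Process.PointStationaryLaw
import Literature.MathematicalPhysics.StatisticalMechanics.RootEnergy
import Literature.MathematicalPhysics.StatisticalMechanics.BarlowStacking
import HarnessLib

/-!
# `SlackRigidity` (stmt-AtomisticToContinuum-11960), line `priced-floors-palm-exactification`: vocabulary

Definitions file of the line (lead c19).  The crux `ThreeConeCertificate.SlackRigidity` is proved along
this line through `PalmRigidity` (item 9224, landed closure p122051) from the two priced finite-volume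
inequalities `CoerciveTwoShellGap` (13956) and `NearFieldConvexity` (13958) of route
`PhononSlackCertificates`, a Palm-averaging transfer, an exact local-to-global layer lemma and Hägg
selection in mean.  This file holds ONLY the shared vocabulary and the registered stub STATEMENTS (as
named `Prop`s), so that every stub file and the assembling file state their theorems against the same
names:

* `layeredSet A a s z`, `IsAdmissibleLayering a s z` — the layered family of item 13958 (set form);
* `LayeredAt ρ₁ ρ₂ η S y` — two-way `η`-matching of `S` near `y` with a layered set (`S`-side radius `ρ₁`,
  pattern-side radius `ρ₂`; item 13958's inline clause is `LayeredAt 2 2 η`);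
* `ExactLayeredAt S y` — the exact (`η = 0`) version, normalised (`z 0 = 0`, pattern-side radius `9/5`);
* `IsMinimisingLaw δ P` — the standing law hypotheses (a.s. rooted `δ`-hard-core, point-stationary,
  `E_P[h] ≤ e*`); `ClusterSelectionFor δ G` — the conclusion of the selection engine for the event `G`;
  `GlobalLayered S` — `S` is one admissible layered set after a translation; `IsOptimalHcpSample μ` — the
  conclusion of `PalmRigidity` (item 9224) for one sample, verbatim;
* elementary API: monotonicity of `LayeredAt` in the radii / tolerance and its translation covariance.

The registered stub SIGNATURES of the skeleton are explicit terms over these predicates (no closed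
`Prop` constants are introduced).

`eStar = ⨅_Q e(Q)` is `MinimiserShells.Negative.LoadBearing.eStar` (shared with the `SlackRigidityLaw*`
files).  All `[folklore]`.
-/

noncomputable section

open MeasureTheory Filter Set
open scoped ENNReal BigOperators Topology

namespace Summit.AtomisticToContinuum.Crystallization.Theorems.SlackRigidityPricedFloors

open Literature.Probability.Process
open Literature.MathematicalPhysics.StatisticalMechanics
open Summit.AtomisticToContinuum.Crystallization.Theses.PhononSlackCertificates
  (CoerciveTwoShellGap NearFieldConvexity)
open Summit.AtomisticToContinuum.Crystallization.Theorems.MinimiserShells.Negative.LoadBearing (eStar)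

/-- Ambient space `ℝ³`. -/
abbrev E3 := EuclideanSpace ℝ (Fin 3)

/-! ## The layered family of item 13958 (set form) -/

/-- **Layered set** (the inline family of `NearFieldConvexity`, item 13958): the rigid image under the
linear isometry `A` of triangular layers of spacing `a` in hole registry along the Hägg word `s`, layer
`m` at height `z m`: `{A (i u_a + j v_a + (haggLabel s m) w_a + (z m) e₃) : m i j ∈ ℤ}`. -/
def layeredSet (A : E3 →ₗᵢ[ℝ] E3) (a : ℝ) (s : ℤ → ℤ) (z : ℤ → ℝ) : Set E3 :=
  {p | ∃ m i j : ℤ, p = A (((i : ℝ) • triangularVec₁ a) + ((j : ℝ) • triangularVec₂ a) +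
    ((haggLabel s m : ℝ) • barlowOffset a) + (z m • layerNormal 1))}

/-- **Admissible layering data** (item 13958 verbatim): in-plane spacing `a ∈ [47/50, 1]`, a Hägg word
`s`, free interlayer spacings `z (m+1) − z m ∈ [39a/50, 17a/20]`. -/
def IsAdmissibleLayering (a : ℝ) (s : ℤ → ℤ) (z : ℤ → ℝ) : Prop :=
  47 / 50 ≤ a ∧ a ≤ 1 ∧ IsHaggSeq s ∧
    ∀ m : ℤ, 39 / 50 * a ≤ z (m + 1) - z m ∧ z (m + 1) - z m ≤ 17 / 20 * a

/-- **`η`-layered neighbourhood** of the point `y` of the configuration `S`, with `S`-side radius `ρ₁`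
and pattern-side radius `ρ₂`: after a translation `t`, every point of `S` within `ρ₁` of `y` is within
`η` of an admissible layered set, and every point of that layered set within `ρ₂` of `y + t` is within
`η` of a translated point of `S`.  Item 13958's inline (negated) clause is `LayeredAt 2 2 η`. -/
def LayeredAt (ρ₁ ρ₂ η : ℝ) (S : Set E3) (y : E3) : Prop :=
  ∃ (A : E3 →ₗᵢ[ℝ] E3) (t : E3) (a : ℝ) (s : ℤ → ℤ) (z : ℤ → ℝ), IsAdmissibleLayering a s z ∧
    (∀ x ∈ S, dist x y ≤ ρ₁ → ∃ p ∈ layeredSet A a s z, dist (x + t) p ≤ η) ∧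
    (∀ p ∈ layeredSet A a s z, dist p (y + t) ≤ ρ₂ → ∃ x ∈ S, dist (x + t) p ≤ η)

/-- **Exactly layered neighbourhood** of the point `y` of `S` (the `η = 0` case, normalised so that the
pattern is centred at `y`, i.e. `z 0 = 0` and `0 ∈ layeredSet`): every point of `S` within `2` of `y`
is `y +` a pattern point, and every pattern point of norm `≤ 9/5` is (after adding `y`) a point of `S`. -/
def ExactLayeredAt (S : Set E3) (y : E3) : Prop :=
  ∃ (A : E3 →ₗᵢ[ℝ] E3) (a : ℝ) (s : ℤ → ℤ) (z : ℤ → ℝ), IsAdmissibleLayering a s z ∧ z 0 = 0 ∧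
    (∀ x ∈ S, dist x y ≤ 2 → x - y ∈ layeredSet A a s z) ∧
    (∀ p ∈ layeredSet A a s z, ‖p‖ ≤ 9 / 5 → y + p ∈ S)

/-! ## Elementary API -/

/-- `LayeredAt` is antitone in the two radii and monotone in the tolerance. [folklore] -/
theorem LayeredAt.mono {ρ₁ ρ₂ η ρ₁' ρ₂' η' : ℝ} {S : Set E3} {y : E3}
    (h : LayeredAt ρ₁ ρ₂ η S y) (h₁ : ρ₁' ≤ ρ₁) (h₂ : ρ₂' ≤ ρ₂) (hη : η ≤ η') :
    LayeredAt ρ₁' ρ₂' η' S y := by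
  obtain ⟨A, t, a, s, z, hadm, hS, hL⟩ := h
  refine ⟨A, t, a, s, z, hadm, fun x hx hd => ?_, fun p hp hd => ?_⟩
  · obtain ⟨p, hp, hpd⟩ := hS x hx (hd.trans h₁)
    exact ⟨p, hp, hpd.trans hη⟩
  · obtain ⟨x, hx, hxd⟩ := hL p hp (hd.trans h₂)
    exact ⟨x, hx, hxd.trans hη⟩

/-- **Translation covariance**: the configuration re-rooted at `y` (translated by `-y`) is
`η`-layered at `0` iff the configuration is `η`-layered at `y`. [folklore] -/
theorem layeredAt_image_sub_iff (ρ₁ ρ₂ η : ℝ) (S : Set E3) (y : E3) :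
    LayeredAt ρ₁ ρ₂ η ((fun z => z - y) '' S) 0 ↔ LayeredAt ρ₁ ρ₂ η S y := by
  constructor
  · rintro ⟨A, t, a, s, z, hadm, hS, hL⟩
    refine ⟨A, t - y, a, s, z, hadm, fun x hx hd => ?_, fun p hp hd => ?_⟩
    · obtain ⟨p, hp, hpd⟩ := hS (x - y) ⟨x, hx, rfl⟩ (by rwa [dist_zero_right, ← dist_eq_norm])
      exact ⟨p, hp, by rwa [show x + (t - y) = x - y + t by abel]⟩
    · obtain ⟨x', ⟨x, hx, rfl⟩, hxd⟩ := hL p hp (by rwa [zero_add, show t = y + (t - y) by abel])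
      exact ⟨x, hx, by rwa [show x + (t - y) = x - y + t by abel]⟩
  · rintro ⟨A, t, a, s, z, hadm, hS, hL⟩
    refine ⟨A, t + y, a, s, z, hadm, ?_, fun p hp hd => ?_⟩
    · rintro _ ⟨x, hx, rfl⟩ hd
      rw [dist_zero_right, ← dist_eq_norm] at hd
      obtain ⟨p, hp, hpd⟩ := hS x hx hd
      exact ⟨p, hp, by rwa [show x - y + (t + y) = x + t by abel]⟩
    · obtain ⟨x, hx, hxd⟩ := hL p hp (by rwa [zero_add, add_comm t y] at hd)
      exact ⟨x - y, ⟨x, hx, rfl⟩, by rwa [show x - y + (t + y) = x + t by abel]⟩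

/-- The atoms of the re-rooted counting configuration, layered at `0`, versus the original
configuration layered at `y`. [folklore] -/
theorem layeredAt_atoms_map_sub_iff (ρ₁ ρ₂ η : ℝ) (μ : Measure E3) (y : E3) :
    LayeredAt ρ₁ ρ₂ η (atoms (μ.map (fun z => z - y))) 0 ↔ LayeredAt ρ₁ ρ₂ η (atoms μ) y := by
  rw [atoms_map_sub_right, layeredAt_image_sub_iff]

/-- **Re-rooting covariance of `LayeredAt`** (registered sub-goal `layeredAt_reroot_iff` of the line:
the form consumed by the root-to-everywhere transfer `PalmUnimodularRigidity.ae_forall_map_sub_of_ae`).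
[folklore] -/
theorem layeredAt_reroot_iff : ∀ (ρ₁ ρ₂ η : ℝ) (μ : Measure E3) (y : E3), LayeredAt ρ₁ ρ₂ η (atoms (μ.map (fun z => z - y))) 0 ↔ LayeredAt ρ₁ ρ₂ η (atoms μ) y :=
  layeredAt_atoms_map_sub_iff

/-! ## Predicates used by the registered stub signatures -/

/-- **Standing law hypotheses** of the Palm side (items 9224–9226 inline them): `P` is a.s. carried by
rooted `δ`-hard-core configurations, is point-stationary (Mecke identity) and is minimising,
`E_P[h] ≤ e* = ⨅_Q e(Q)`.  (`IsProbabilityMeasure P` is kept as a separate instance hypothesis.) -/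
def IsMinimisingLaw (δ : ℝ) (P : Measure (Measure E3)) : Prop :=
  (∀ᵐ μ ∂P, IsRootedHardCore δ μ) ∧ IsPointStationaryLaw P ∧
    (∫ μ, rootEnergy lennardJones μ ∂P) ≤ eStar

/-- **Conclusion of the cluster-selection engine** for the hard core `δ` and the event `G` (the law `P`
enters only through the hypotheses of the engine, not through its conclusion):
there is `b > 0` such that for every deepness radius `R`, slack `η > 0` and size `M` some finite cluster
`T` inside a `δ`-separated sample `S` has `#T ≥ M`, energy `𝓔(T) ≤ #T e* + η #T`, and at least `b · #T`
points `y` that are `R`-deep (`S ∩ B̄(y,R) ⊆ T`) and bad (`θ_y (count|S) ∉ G`).  (Generic form of the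
conclusion of `SlackRigidityLawSelection.exists_badCluster`, p131361.) -/
def ClusterSelectionFor (δ : ℝ) (G : Set (Measure E3)) : Prop :=
  ∃ b : ℝ, 0 < b ∧ ∀ (R η : ℝ) (M : ℕ), 0 < η →
    ∃ (S : Set E3) (T : Finset E3),
      (∀ x ∈ S, ∀ y ∈ S, x ≠ y → δ ≤ dist x y) ∧ (↑T : Set E3) ⊆ S ∧ M ≤ T.card ∧
      interactionEnergy lennardJones (fun i : Fin T.card => ((T.equivFin.symm i : T) : E3)) ≤
        (T.card : ℝ) * eStar + η * T.card ∧
      b * T.card ≤ (Nat.card {y : T // S ∩ Metric.closedBall (y : E3) R ⊆ ↑T ∧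
        ((Measure.count : Measure E3).restrict S).map (fun z => z - (y : E3)) ∉ G} : ℝ)

/-- **Globally layered configuration**: after one translation, `S` is exactly an admissible layered
set. -/
def GlobalLayered (S : Set E3) : Prop :=
  ∃ (A : E3 →ₗᵢ[ℝ] E3) (t : E3) (a : ℝ) (s : ℤ → ℤ) (z : ℤ → ℝ), IsAdmissibleLayering a s z ∧
    (fun x => x + t) '' S = layeredSet A a s z

/-- **Optimal rotated relaxed hcp sample** — the conclusion of `PalmRigidity` (item 9224) for one
configuration, verbatim: `μ = count|A(hcpStacking a h)` with `(a,h) ∈ [1/2,2]²` and `e(hcp a h) = e*`. -/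
def IsOptimalHcpSample (μ : Measure E3) : Prop :=
  ∃ a h : ℝ, ∃ ha : a ≠ 0, ∃ hh : h ≠ 0, 1 / 2 ≤ a ∧ a ≤ 2 ∧ 1 / 2 ≤ h ∧ h ≤ 2 ∧
    ∃ A : E3 ≃ₗᵢ[ℝ] E3,
      (hcpPeriodicConfiguration ha hh).energyPerParticle lennardJones = eStar ∧
      μ = (Measure.count : Measure E3).restrict (A '' hcpStacking a h)

end Summit.AtomisticToContinuum.Crystallization.Theorems.SlackRigidityPricedFloors

end
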